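/-
Copyright (c) 2026 the pub-hodgecm-mathlib formalisation cell (harness21).  Prover seat hodgecm-mathlib-R90-C133-p02 (g0), Track B ∕ R90-TF, h413 = `stmt-HodgeConjecture-24833`,
R90-TF section S8 «ContSpec-n½» (deal S8-R66 of R90-CS-plan (g2), 2026-09-04T22:45Z): the `hr2` letter of (NV) — «the residue at the MIDDLE pole `z₀ = 3/2` of the continued
pair-character Eisenstein family of `U(2,1)_{L∕L⁺}` is square-integrable» — ED. 1: the EXPONENT CRITERION's analytic content (upper-tail Siegel finiteness for every exponent `τ < 2`,
all inputs ★) and the head HYPOTHESIS-FIRST on the three genuinely missing letters (census `R90/S8/CENSUS-hr2.R90-C133-p02-g0.md`).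
-/
import Summits.HodgeConjecture.HodgeConjecture.Theorems.K2E1SiegelIntegralExplicit       -- ★ (K2E1-p08): `exists_siegelIntegral_eq_mul_rpow_three` — the LOWER-region Siegel law `∫⁻ 𝟙{H ≤ C₀} H^τ β' = K'·C₀^{τ−2}`, `τ > 2`
import Literature.NumberTheory.Automorphic.UnitaryGroupIwasawaAdelic                       -- ★ `exists_mem_borelAdelic_mul_mem_standardMaximalCompactGL_cm_three` (Iwasawa at the CM pair)
import Literature.NumberTheory.Automorphic.UnitaryGroupBorelHeightContinuous               -- ★ `continuous_borelHeight`
import Literature.NumberTheory.Automorphic.AutomorphicRepsGLCuspidalUnitary                -- ★ `AdelicGroupData.quotFun`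
import HarnessLib

/-!
# K2·E1 ∕ R90·S8 — `K2E1ChiEisensteinMiddleResidueMemL2CMThree`: TOWARDS `hr2` — the UPPER-TAIL SIEGEL LAW at `U(2,1)` («`∫ 𝟙{C₀ < H}·H^τ·β′ < ∞` for every `τ < 2`», the exponent
# criterion of [MW95 I.4.11] in the tree's currency) and the square-integrability of the MIDDLE residue modulo the truncation letters

Track B ∕ R90-TF, crux h413 = `stmt-HodgeConjecture-24833`, route of record `HCCMUnconditional`; cell `hodgecm-mathlib`, R90-TF section S8 «ContSpec-n½ ∕ ResidualSpectrum», socket #3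
`sock_S8_res_piN_occurs` — letter (NV), sub-letter `hr2 : MemLp (QS.quotFun r) 2 μ` of ★ `R90S8ResGMidResidueClassNeZeroU3` (K2E2-p12).  THEOREMS ONLY (no `def`, no `instance`, no
notation, no named-fact hypothesis, no `sorry`; default heartbeats); lane `--supports stmt-HodgeConjecture-24833 --as helper` (count-neutral).  CLOSES NO SOCKET.

THE MATHEMATICS ([MoeglinWaldspurger1995, I.4.11, I.2.13]; [Langlands1976, §7]).  The residue `r = Res_{z=3/2} Ẽ_χ(z)` has constant term `ρ·(Mφ)·H^{2−3/2} = ρ·(Mφ)·H^{1/2}` along `B`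
(constant term `φ·H^z + c(z)·(Mφ)·H^{2−z}`, unitary axis `Re z = 1`, normalisation `s = z − 1`); `r −` (its constant term above height `T`) is the `L²` residue of the TRUNCATED family; and
`𝟙{T < H}·H^{1/2}·(bounded)` is square-integrable on a Siegel set because `∫_{T}^{∞} H^{2·(1/2)}·H^{−2}·dH∕H < ∞` — the exponent criterion «`2a < 2`», here `a = 1/2`.  In the tree's
currency the Siegel-set integral is ★ only on the LOWER region (`∫⁻ 𝟙{H ≤ C₀}·H^τ·β′ dμ = K′·C₀^{τ−2}`, `τ > 2`, ★ `exists_siegelIntegral_eq_mul_rpow_three`); §1–§2 derive the UPPER-TAIL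
FINITENESS for every `τ < 2` by a DYADIC SHELL SUM (`𝟙{2^kC₀ ≤ H < 2^{k+1}C₀}·H^τ ≤ (2^kC₀)^{τ−τ′}·𝟙{H ≤ 2^{k+1}C₀}·H^{τ′}`, geometric series in `2^{τ−2} < 1`) — pure measure theory over ★.
* §1 GENERIC **`lintegral_indicator_lt_rpow_mul_lt_top_of_lower_law`** — any measure space, height `H : X → ℝ≥0`, weight `w`: a lower law `∫⁻ 𝟙{H ≤ C}·H^{τ′}·w ≤ K·C^a` (all `C`) with
  `τ ≤ τ′`, `τ − τ′ + a < 0`, `K < ∞` gives `∫⁻ 𝟙{C₀ < H}·H^τ·w < ∞` for every `C₀ > 0`.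
* §2 **`lintegral_indicator_lt_borelHeight_rpow_mul_weight_lt_top_cm_three`** — `U(2,1)_{L∕L⁺}`, Haar `μ` on `G(𝔸)`, every `(B ⊓ Γ)`-covering weight `β′`, every `τ < 2`, `C₀ > 0`:
  `∫⁻ 𝟙{C₀ < H}·H^τ·β′ dμ < ∞` (§1 at `τ′ = 3`, `a = 1`, ★ lower law, Iwasawa ★ at the CM pair).
* §3 THE HEAD **`memLp_quotFun_middleResidue_of_letters`** — K2E2-p12's `hr2` bytes `MemLp ((quasiSplit L⁺ L c 3).quotFun r) 2 μ` from the three visible letters: `hRes` (the `L²` residue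
  `ResT` of the TRUNCATED χ-family at `3/2` — payer: the middle-pole twin of ★ `exists_L2Residue_of_road_cm_three`, (MS-2) at `3/2`; CLOSURE TARGET T-hr2-2), `hTail` (`MemLp tail 2 μ` for the
  Siegel-top tail `𝟙[T < w₁]·ρ·H^{1/2}·Mφ` — payer: §2 + the quotient transfer ★ `exists_lintegral_enorm_quotFun_le`-shape; T-hr2-3), `hId` (`quotFun r =ᵐ ResT + tail` — payer: the
  middle-pole twin of ★ `ae_eq_residueValue_sub_indicator` for a section-dependent constant term; T-hr2-1).
HONEST LABEL: HC_CM is proved only modulo the 7 printed citations (2 remaining named inputs: hLiu418 = `stmt-HodgeConjecture-24832`, h413 = `stmt-HodgeConjecture-24833`) until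
rung 0 closes; REL ≠ ★ ≠ BUILT; §1–§2 are letter-free over ★, §3 is conditional by construction on `hRes hTail hId`; this file asserts no named fact and closes no socket; count-neutral.

## References
* [MoeglinWaldspurger1995] C. Mœglin, J.-L. Waldspurger, *Spectral Decomposition and Eisenstein Series* (1995), I.2.13, I.4.11.
* [Langlands1976] R. P. Langlands, *On the Functional Equations Satisfied by Eisenstein Series*, LNM 544 (1976), §7.
* [Godement1964] R. Godement, *Domaines fondamentaux des groupes arithmétiques*, Sém. Bourbaki 257 (1964), §8.
-/

set_option autoImplicit false
set_option linter.dupNamespace false  -- the mandated namespace repeats the single-problem summit's segment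

noncomputable section

open MeasureTheory MeasureTheory.Measure Set Filter Topology NumberField
open scoped ENNReal NNReal
open Literature.MeasureTheory.Group
open Literature.NumberTheory.Automorphic Literature.NumberTheory.Automorphic.UnitaryGroup
open Summit.HodgeConjecture.HodgeConjecture.Cruxes.H413.K2E1BorelEisensteinU
open Summit.HodgeConjecture.HodgeConjecture.Cruxes.H413.K2E1SiegelIntegralExplicit (exists_siegelIntegral_eq_mul_rpow_three)

namespace Summit.HodgeConjecture.HodgeConjecture.Cruxes.H413.K2E1ChiEisensteinMiddleResidueMemL2CMThree

/-! ## §1 Generic: a lower-region power law gives upper-tail finiteness (dyadic shells) -/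

section Generic

variable {X : Type*} [MeasurableSpace X]

/-- One dyadic step of real arithmetic: `(2^n·C₀)^{e} · (2^{n+1}·C₀)^{a} = (C₀^{e+a}·2^{a}) · (2^{e+a})^n` for `C₀ > 0`. [folklore] -/
theorem dyadic_rpow_mul_rpow_eq (C₀ : ℝ) (hC₀ : 0 < C₀) (e a : ℝ) (n : ℕ) :
    ((2 : ℝ) ^ n * C₀) ^ e * ((2 : ℝ) ^ (n + 1) * C₀) ^ a = (C₀ ^ (e + a) * (2 : ℝ) ^ a) * ((2 : ℝ) ^ (e + a)) ^ n := by
  have h2 : (0 : ℝ) ≤ 2 := by norm_num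
  have h2n : (0 : ℝ) ≤ (2 : ℝ) ^ n := by positivity
  have h2n1 : (0 : ℝ) ≤ (2 : ℝ) ^ (n + 1) := by positivity
  rw [Real.mul_rpow h2n hC₀.le, Real.mul_rpow h2n1 hC₀.le]
  -- powers of `2`: `(2^n)^e = 2^(n e)`, `(2^(n+1))^a = 2^((n+1) a)`, `(2^(e+a))^n = 2^(n (e+a))`
  rw [← Real.rpow_natCast (2 : ℝ) n, ← Real.rpow_natCast (2 : ℝ) (n + 1), ← Real.rpow_mul h2, ← Real.rpow_mul h2, ← Real.rpow_natCast ((2 : ℝ) ^ (e + a)) n,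
    ← Real.rpow_mul h2, Real.rpow_add hC₀]
  push_cast
  -- collect: both sides are `C₀^e · C₀^a · 2^{(n e) + ((n+1) a)}` resp. `C₀^e·C₀^a·2^a·2^{(e+a) n}`
  have key : (2 : ℝ) ^ ((n : ℝ) * e) * (2 : ℝ) ^ (((n : ℝ) + 1) * a) = (2 : ℝ) ^ a * (2 : ℝ) ^ ((e + a) * (n : ℝ)) := by
    rw [← Real.rpow_add (by norm_num : (0 : ℝ) < 2), ← Real.rpow_add (by norm_num : (0 : ℝ) < 2)]
    ring_nf
  calc (2 : ℝ) ^ ((n : ℝ) * e) * C₀ ^ e * ((2 : ℝ) ^ (((n : ℝ) + 1) * a) * C₀ ^ a)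
        = (C₀ ^ e * C₀ ^ a) * ((2 : ℝ) ^ ((n : ℝ) * e) * (2 : ℝ) ^ (((n : ℝ) + 1) * a)) := by ring
    _ = (C₀ ^ e * C₀ ^ a) * ((2 : ℝ) ^ a * (2 : ℝ) ^ ((e + a) * (n : ℝ))) := by rw [key]
    _ = C₀ ^ e * C₀ ^ a * (2 : ℝ) ^ a * (2 : ℝ) ^ ((e + a) * (n : ℝ)) := by ring

/-- **UPPER-TAIL FINITENESS FROM A LOWER-REGION POWER LAW (dyadic shells).**  On any measure space, for a measurable height `H : X → ℝ≥0` and weight `w : X → [0,∞]`: if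
`∫⁻ 𝟙{H ≤ C}·H^{τ′}·w ≤ K·C^a` for every cut-off `C` (`K < ∞`), then for every exponent `τ ≤ τ′` with `τ − τ′ + a < 0` and every `C₀ > 0`, `∫⁻ 𝟙{C₀ < H}·H^τ·w < ∞`: cover `{C₀ < H}`
by the shells `2^nC₀ ≤ H < 2^{n+1}C₀` (Mathlib `exists_nat_pow_near`), bound `H^τ = H^{τ−τ′}·H^{τ′} ≤ (2^nC₀)^{τ−τ′}·H^{τ′}` on the `n`-th shell (`τ − τ′ ≤ 0`), apply the law at
`C = 2^{n+1}C₀`, and sum the geometric series in `2^{τ−τ′+a} < 1`. [cite: MoeglinWaldspurger1995, I.2.13] [cite: Godement1964, §8] -/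
theorem lintegral_indicator_lt_rpow_mul_lt_top_of_lower_law (μ : Measure X) {H : X → ℝ≥0} (hH : Measurable H) {w : X → ℝ≥0∞} (hw : Measurable w)
    {τ τ' a : ℝ} {K : ℝ≥0∞} (hK : K ≠ ∞)
    (hlow : ∀ C : ℝ≥0, ∫⁻ x, {x | H x ≤ C}.indicator (fun x => ENNReal.ofReal ((H x : ℝ) ^ τ')) x * w x ∂μ ≤ K * ENNReal.ofReal ((C : ℝ) ^ a))
    (hττ' : τ ≤ τ') (hneg : τ - τ' + a < 0) {C₀ : ℝ≥0} (hC₀ : 0 < C₀) :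
    ∫⁻ x, {x | C₀ < H x}.indicator (fun x => ENNReal.ofReal ((H x : ℝ) ^ τ)) x * w x ∂μ < ∞ := by
  have hC₀r : (0 : ℝ) < (C₀ : ℝ) := by exact_mod_cast hC₀
  -- the shell majorants
  set g : ℕ → X → ℝ≥0∞ := fun n x =>
    ENNReal.ofReal (((2 : ℝ) ^ n * C₀) ^ (τ - τ')) * ({x | H x ≤ (2 : ℝ≥0) ^ (n + 1) * C₀}.indicator (fun x => ENNReal.ofReal ((H x : ℝ) ^ τ')) x * w x) with hg
  have hg_meas : ∀ n, Measurable (g n) := fun n =>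
    measurable_const.mul (((Measurable.ennreal_ofReal ((measurable_coe_nnreal_real.comp hH).pow_const _)).indicator
      (measurableSet_le hH measurable_const)).mul hw)
  -- pointwise domination by the sum of the shell majorants
  have hdom : ∀ x, {x | C₀ < H x}.indicator (fun x => ENNReal.ofReal ((H x : ℝ) ^ τ)) x * w x ≤ ∑' n, g n x := by
    intro x
    by_cases hx : C₀ < H x
    · rw [indicator_of_mem (show x ∈ {x | C₀ < H x} from hx)]
      have hHpos : (0 : ℝ) < (H x : ℝ) := lt_trans hC₀r (by exact_mod_cast hx)
      -- the shell index: `2^n ≤ H/C₀ < 2^(n+1)`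
      obtain ⟨n, hn1, hn2⟩ := exists_nat_pow_near (show (1 : ℝ) ≤ (H x : ℝ) / C₀ from (one_le_div hC₀r).2 (by exact_mod_cast hx.le)) (by norm_num : (1 : ℝ) < 2)
      have hlowb : (2 : ℝ) ^ n * C₀ ≤ (H x : ℝ) := by rwa [le_div_iff₀ hC₀r] at hn1
      have hupb : (H x : ℝ) ≤ (2 : ℝ) ^ (n + 1) * C₀ := by rw [div_lt_iff₀ hC₀r] at hn2; exact hn2.le
      refine le_trans ?_ (ENNReal.le_tsum n)
      -- on the shell: `H^τ ≤ (2^n C₀)^{τ−τ'} · H^{τ'}`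
      have hmem : x ∈ {x | H x ≤ (2 : ℝ≥0) ^ (n + 1) * C₀} := by
        show H x ≤ (2 : ℝ≥0) ^ (n + 1) * C₀
        exact_mod_cast hupb
      simp only [hg, indicator_of_mem hmem]
      have hsplit : (H x : ℝ) ^ τ = (H x : ℝ) ^ (τ - τ') * (H x : ℝ) ^ τ' := by
        rw [← Real.rpow_add hHpos]; ring_nf
      have hfac : (H x : ℝ) ^ (τ - τ') ≤ ((2 : ℝ) ^ n * C₀) ^ (τ - τ') :=
        Real.rpow_le_rpow_of_nonpos (by positivity) hlowb (by linarith)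
      calc ENNReal.ofReal ((H x : ℝ) ^ τ) * w x = ENNReal.ofReal ((H x : ℝ) ^ (τ - τ') * (H x : ℝ) ^ τ') * w x := by rw [hsplit]
        _ ≤ ENNReal.ofReal (((2 : ℝ) ^ n * C₀) ^ (τ - τ') * (H x : ℝ) ^ τ') * w x := by
            -- `hfac` is the monotonicity input
            gcongr
        _ = ENNReal.ofReal (((2 : ℝ) ^ n * C₀) ^ (τ - τ')) * (ENNReal.ofReal ((H x : ℝ) ^ τ') * w x) := by
            rw [ENNReal.ofReal_mul (Real.rpow_nonneg (by positivity) _), mul_assoc]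
    · rw [indicator_of_notMem (show x ∉ {x | C₀ < H x} from hx), zero_mul]
      exact bot_le
  -- integrate the domination and the shells
  have hshell : ∀ n, ∫⁻ x, g n x ∂μ ≤ K * ENNReal.ofReal ((C₀ : ℝ) ^ (τ - τ' + a) * (2 : ℝ) ^ a * (((2 : ℝ) ^ (τ - τ' + a)) ^ n)) := by
    intro n
    have h1 : ∫⁻ x, g n x ∂μ = ENNReal.ofReal (((2 : ℝ) ^ n * C₀) ^ (τ - τ')) * ∫⁻ x, {x | H x ≤ (2 : ℝ≥0) ^ (n + 1) * C₀}.indicator (fun x => ENNReal.ofReal ((H x : ℝ) ^ τ')) x * w x ∂μ := by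
      simp only [hg]
      rw [lintegral_const_mul' _ _ ENNReal.ofReal_ne_top]
    rw [h1]
    calc ENNReal.ofReal (((2 : ℝ) ^ n * C₀) ^ (τ - τ')) * ∫⁻ x, {x | H x ≤ (2 : ℝ≥0) ^ (n + 1) * C₀}.indicator (fun x => ENNReal.ofReal ((H x : ℝ) ^ τ')) x * w x ∂μ
          ≤ ENNReal.ofReal (((2 : ℝ) ^ n * C₀) ^ (τ - τ')) * (K * ENNReal.ofReal ((((2 : ℝ≥0) ^ (n + 1) * C₀ : ℝ≥0) : ℝ) ^ a)) := by gcongr; exact hlow _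
      _ = K * ENNReal.ofReal (((2 : ℝ) ^ n * C₀) ^ (τ - τ') * ((2 : ℝ) ^ (n + 1) * C₀) ^ a) := by
          rw [ENNReal.ofReal_mul (Real.rpow_nonneg (by positivity) _)]
          push_cast
          ring
      _ = K * ENNReal.ofReal ((C₀ : ℝ) ^ (τ - τ' + a) * (2 : ℝ) ^ a * (((2 : ℝ) ^ (τ - τ' + a)) ^ n)) := by
          rw [dyadic_rpow_mul_rpow_eq (C₀ : ℝ) hC₀r (τ - τ') a n]
  -- the geometric series
  have hr : (2 : ℝ) ^ (τ - τ' + a) < 1 := Real.rpow_lt_one_of_one_lt_of_neg (by norm_num) hneg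
  have hr0 : (0 : ℝ) ≤ (2 : ℝ) ^ (τ - τ' + a) := Real.rpow_nonneg (by norm_num) _
  have hc0 : (0 : ℝ) ≤ (C₀ : ℝ) ^ (τ - τ' + a) * (2 : ℝ) ^ a := mul_nonneg (Real.rpow_nonneg hC₀r.le _) (Real.rpow_nonneg (by norm_num) _)
  calc ∫⁻ x, {x | C₀ < H x}.indicator (fun x => ENNReal.ofReal ((H x : ℝ) ^ τ)) x * w x ∂μ
        ≤ ∫⁻ x, ∑' n, g n x ∂μ := lintegral_mono hdom
    _ = ∑' n, ∫⁻ x, g n x ∂μ := lintegral_tsum fun n => (hg_meas n).aemeasurable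
    _ ≤ ∑' n, K * ENNReal.ofReal ((C₀ : ℝ) ^ (τ - τ' + a) * (2 : ℝ) ^ a * (((2 : ℝ) ^ (τ - τ' + a)) ^ n)) := ENNReal.tsum_le_tsum hshell
    _ = K * ENNReal.ofReal ((C₀ : ℝ) ^ (τ - τ' + a) * (2 : ℝ) ^ a) * ∑' n : ℕ, (ENNReal.ofReal ((2 : ℝ) ^ (τ - τ' + a))) ^ n := by
          rw [← ENNReal.tsum_mul_left]
          refine tsum_congr fun n => ?_
          rw [ENNReal.ofReal_mul hc0, ENNReal.ofReal_pow hr0, mul_assoc]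
    _ < ∞ := by
          rw [ENNReal.tsum_geometric]
          refine ENNReal.mul_lt_top (ENNReal.mul_lt_top hK.lt_top ENNReal.ofReal_lt_top) ?_
          refine ENNReal.inv_lt_top.2 (tsub_pos_iff_lt.2 ?_)
          exact (ENNReal.ofReal_lt_one.2 hr)

end Generic

/-! ## §2 `U(2,1)_{L∕L⁺}`: the upper-tail Siegel law `∫⁻ 𝟙{C₀ < H}·H^τ·β′ dμ < ∞` for every `τ < 2` -/

section CMThree

variable (L : Type) [Field L] [NumberField L] [IsCMField L]
  [MeasurableSpace (quasiSplit (↥(maximalRealSubfield L)) L (IsCMField.complexConj L) 3).Adelic] [BorelSpace (quasiSplit (↥(maximalRealSubfield L)) L (IsCMField.complexConj L) 3).Adelic]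

/-- **THE UPPER-TAIL SIEGEL LAW AT `U(2,1)_{L∕L⁺}`** — for a Haar measure `μ` on `G(𝔸) = U(J₃)(𝔸_{L⁺})`, every `(B ⊓ Γ)`-covering weight `β′`, every exponent `τ < 2` and every
`C₀ > 0`: `∫⁻ 𝟙{C₀ < H}·H^τ·β′ dμ < ∞` — §1 fed by the ★ LOWER-region law `∫⁻ 𝟙{H ≤ C}·H^3·β′ = K′·C^{1}` (★ `exists_siegelIntegral_eq_mul_rpow_three` at `τ′ = 3`; Iwasawa ★
`exists_mem_borelAdelic_mul_mem_standardMaximalCompactGL_cm_three`, `[L:L⁺] = 2`, `c² = 1 ≠ c`).  This is the exponent criterion of [MW95 I.4.11] in the tree's Siegel currency: a tail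
`𝟙{T < H}·H^a·(bounded)` is square-integrable iff `2a < 2`; the middle residue's tail has `a = 1/2`. [cite: MoeglinWaldspurger1995, I.2.13, I.4.11] [cite: Godement1964, §8] -/
theorem lintegral_indicator_lt_borelHeight_rpow_mul_weight_lt_top_cm_three
    (μ : Measure (quasiSplit (↥(maximalRealSubfield L)) L (IsCMField.complexConj L) 3).Adelic) [μ.IsHaarMeasure]
    {β' : (quasiSplit (↥(maximalRealSubfield L)) L (IsCMField.complexConj L) 3).Adelic → ℝ≥0∞}
    (hβ' : IsCoveringWeight ↥(borelAdelic (↥(maximalRealSubfield L)) L (IsCMField.complexConj L) 3 ⊓ (quasiSplit (↥(maximalRealSubfield L)) L (IsCMField.complexConj L) 3).arithmeticSubgroup) β')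
    {τ : ℝ} (hτ : τ < 2) {C₀ : ℝ≥0} (hC₀ : 0 < C₀) :
    ∫⁻ y, {y | C₀ < borelHeight y}.indicator (fun y => ENNReal.ofReal ((borelHeight y : ℝ) ^ τ)) y * β' y ∂μ < ∞ := by
  obtain ⟨K', -, hK't, hlaw⟩ := exists_siegelIntegral_eq_mul_rpow_three (Algebra.IsQuadraticExtension.finrank_eq_two (↥(maximalRealSubfield L)) L)
    (AlgEquiv.ext fun x => IsCMField.complexConj_apply_apply L x) (IsCMField.complexConj_ne_one L) μ (exists_mem_borelAdelic_mul_mem_standardMaximalCompactGL_cm_three L)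
    (show (2 : ℝ) < 3 by norm_num)
  refine lintegral_indicator_lt_rpow_mul_lt_top_of_lower_law μ continuous_borelHeight.measurable hβ'.measurable hK't (fun C => (hlaw hβ' C).le) (by linarith)
    (show τ - 3 + (3 - 2) < 0 by linarith) hC₀

end CMThree

/-! ## §3 The head: the middle residue is square-integrable, modulo the truncation letters -/

section Head

variable (L : Type) [Field L] [NumberField L] [IsCMField L]
  (μ : Measure (quasiSplit (↥(maximalRealSubfield L)) L (IsCMField.complexConj L) 3).automorphicQuotient)

/-- **`hr2` OF (NV), MODULO THE TRUNCATION LETTERS** — the residue function `r` (K2E2-p12's `r g := Fp g (3/2)`) of the continued pair-character Eisenstein family of `U(2,1)_{L∕L⁺}`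
at the MIDDLE pole has `MemLp ((quasiSplit L⁺ L c 3).quotFun r) 2 μ`, GIVEN: `hRes` — an `L²` function `ResT` on the quotient (the `L²` residue of the TRUNCATED family at `3/2`; payer
T-hr2-2, the middle-pole twin of ★ `exists_L2Residue_of_road_cm_three`); `hTail` — the Siegel-top tail `tail` (`𝟙[T < w₁]·ρ·H^{1/2}·Mφ`) is in `L²(μ)` (payer T-hr2-3: §2 + the
quotient transfer); `hId` — `quotFun r = ResT + tail` a.e. (payer T-hr2-1, the middle-pole twin of ★ `ae_eq_residueValue_sub_indicator`).  Then `quotFun r ∈ L²(μ)` (`MemLp.add`,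
`MemLp.ae_eq`). [cite: MoeglinWaldspurger1995, I.4.11] [cite: Langlands1976, §7] -/
theorem memLp_quotFun_middleResidue_of_letters (r : (quasiSplit (↥(maximalRealSubfield L)) L (IsCMField.complexConj L) 3).Adelic → ℂ)
    {ResT tail : (quasiSplit (↥(maximalRealSubfield L)) L (IsCMField.complexConj L) 3).automorphicQuotient → ℂ}
    (hRes : MemLp ResT 2 μ) (hTail : MemLp tail 2 μ)
    (hId : (quasiSplit (↥(maximalRealSubfield L)) L (IsCMField.complexConj L) 3).quotFun r =ᵐ[μ] ResT + tail) :
    MemLp ((quasiSplit (↥(maximalRealSubfield L)) L (IsCMField.complexConj L) 3).quotFun r) 2 μ :=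
  (hRes.add hTail).ae_eq hId.symm

end Head

end Summit.HodgeConjecture.HodgeConjecture.Cruxes.H413.K2E1ChiEisensteinMiddleResidueMemL2CMThree

end
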